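import Summits.QuantumFields.YangMills.Theorems.ColdStartUniversalityLatticeLangevinLiebRobinsonLocalMixing
import HarnessLib

/-!
# Route `ColdStartUniversality` (fixed-cut-off SZZ dynamics; LIEB–ROBINSON / LOCALITY package, file 9):
# the carré du champ from link-Lipschitz constants, and the every-start local mixing theorem with LIPSCHITZ-ONLY hypotheses

Helper file (seat `ym-line-csu-p1`, g30; `--supports stmt-QuantumFields-24809`).  The converse bridge to `…OneLinkOscillation`: there,
`Γ^A(G) ≤ σ²` gave per-link Lipschitz constants `(π/(2√2))σ`; here per-link Lipschitz constants give a carré-du-champ bound: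
* ★★ `frameDeriv_abs_le_of_linkLipschitz` — if `u∘coords` is `ℓ`-Lipschitz in the link `e` (Frobenius distance, other links frozen) then every
  noise-frame derivative at `e` satisfies `|W_(e,ν) u (coords V)| ≤ √2·ℓ` (move the link along `s ↦ e^(s√2𝐩E_ν) V_e`: the frame field IS the
  velocity field of this one-parameter group; `‖e^(sX) − 1‖_F ≤ s‖X‖_F` by the mean value inequality with the isometry `‖X e^(sX)‖_F = ‖X‖_F`);
* ★★ `carre_le_of_linkLipschitz` — `Γ^A(u)(V) ≤ 16·Σ_e ℓ_e²` for a link-Lipschitz profile `ℓ` (`8` noise directions per link);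
* ★★★ `wilson_local_pointwise_mixing_of_linkLipschitz` — the every-start, volume-free mixing theorem of `…LocalMixing` with hypotheses on the
  observable stated purely in terms of a link-Lipschitz profile `ℓ` supported in `Λ` (no carré du champ in the statement):
  `|κ_t(f∘coords)(x) − μ_(β')(f∘coords)| ≤ 12π·#Λ·√(Σ_e ℓ_e²)·((3(λ+ρ)t+1)³ + 2)·e^(−ρt)` at `|β'| < 1/12`, every `L`, every start;
  `wilson_solution_local_pointwise_mixing_of_linkLipschitz` — the same along every strong SZZ solution from a deterministic (e.g. cold) start.
THEOREMS ONLY, no definition, no sorry; [folklore].  HONEST FRAMING: fixed cut-off and FIXED `|β'| < 1/12`; nothing `K`-uniform along the route's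
scaling; `UniformColdStartMixing` (24809) is NOT restated; no crux, rung or summit statement is proved; the Yang–Mills mass gap is NOT proved.
-/

set_option autoImplicit false

noncomputable section

namespace Summit.QuantumFields.YangMills.Theorems.ColdStartUniversality.LiebRobinson

open MeasureTheory ProbabilityTheory Matrix Complex Finset Filter Set Metric
open scoped ComplexConjugate BigOperators Matrix NNReal ENNReal Topology
open Literature.Probability.Process Literature.MathematicalPhysics.QuantumFieldTheory
open Literature.MathematicalPhysics.QuantumFieldTheory.Balaban1983to89
open Literature.MathematicalPhysics.QuantumLattice (fundamentalRep fundamentalLatticeRep continuous_fundamentalRep fundamentalRep_apply)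

variable {L : ℕ} [NeZero L]

/-! ## §1. Frame derivatives from link-Lipschitz constants -/

section Frame

open scoped Matrix.Norms.Operator

/-- `‖E_ν‖_F = 1` for the canonical directions. [folklore] -/
theorem frobNorm_noiseDir (ν : NoiseIdx (fundamentalLatticeRep 2).N) : frobNorm (noiseDir ν) = 1 := by
  have h : frobNorm (noiseDir ν) ^ 2 = 1 := by
    rw [← hsForm_self_eq_frobNorm_sq, hsForm_noiseDir, if_pos rfl]
  have h0 : 0 ≤ frobNorm (noiseDir ν) := frobNorm_nonneg _
  nlinarith [h, h0]

/-- ★★ **Frame derivatives from link-Lipschitz constants.**  If `u` is `C¹` and `u∘coords` is `ℓ`-Lipschitz in the link `e` for the Frobenius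
distance (all other links frozen), then for every noise index `ν` and configuration `V`: `|W_(e,ν) u (coords V)| ≤ √2·ℓ`. [folklore] -/
theorem frameDeriv_abs_le_of_linkLipschitz {u : (Edge 3 L × Fin 2 × Fin 2 × Bool → ℝ) → ℝ} (hu : ContDiff ℝ 1 u) (n : Edge 3 L × NoiseIdx (fundamentalLatticeRep 2).N) {ℓ : ℝ} (hℓ : 0 ≤ ℓ)
    (hLip : ∀ y y' : (GaugeConfig 3 L (Matrix.specialUnitaryGroup (Fin 2) ℂ)), (∀ f, f ≠ n.1 → y f = y' f) →
      |u ((fun (V : GaugeConfig 3 L (Matrix.specialUnitaryGroup (Fin 2) ℂ)) (q : Edge 3 L × Fin (fundamentalLatticeRep 2).N × Fin (fundamentalLatticeRep 2).N × Bool) => (fun z : ℂ => if q.2.2.2 then z.im else z.re) ((fundamentalRep (Fin 2) (V q.1) : Matrix (Fin 2) (Fin 2) ℂ) q.2.1 q.2.2.1)) y) - u ((fun (V : GaugeConfig 3 L (Matrix.specialUnitaryGroup (Fin 2) ℂ)) (q : Edge 3 L × Fin (fundamentalLatticeRep 2).N × Fin (fundamentalLatticeRep 2).N × Bool) => (fun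 z : ℂ => if q.2.2.2 then z.im else z.re) ((fundamentalRep (Fin 2) (V q.1) : Matrix (Fin 2) (Fin 2) ℂ) q.2.1 q.2.2.1)) y')| ≤ ℓ * frobNorm ((y n.1 : Matrix (Fin 2) (Fin 2) ℂ) - (y' n.1 : Matrix (Fin 2) (Fin 2) ℂ)))
    (V : (GaugeConfig 3 L (Matrix.specialUnitaryGroup (Fin 2) ℂ))) :
    |fderiv ℝ u ((fun (V : GaugeConfig 3 L (Matrix.specialUnitaryGroup (Fin 2) ℂ)) (q : Edge 3 L × Fin (fundamentalLatticeRep 2).N × Fin (fundamentalLatticeRep 2).N × Bool) => (fun z : ℂ => if q.2.2.2 then z.im else z.re) ((fundamentalRep (Fin 2) (V q.1) : Matrix (Fin 2) (Fin 2) ℂ) q.2.1 q.2.2.1)) V) (fun q : Edge 3 L × Fin (fundamentalLatticeRep 2).N × Fin (fundamentalLatticeRep 2).N × Bool => if n.1 = q.1 then (fun z : ℂ => if q.2.2.2 then z.im else z.re) (((Real.sqrt 2 : ℂ) • ((fundamentalLatticeRep 2).lieProj (noiseDir n.2) * (fun (ee : Edge 3 L) => Matrix.of fun (i j : Fin (fundamentalLatticeRep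 2).N) => (((fun (V : GaugeConfig 3 L (Matrix.specialUnitaryGroup (Fin 2) ℂ)) (q : Edge 3 L × Fin (fundamentalLatticeRep 2).N × Fin (fundamentalLatticeRep 2).N × Bool) => (fun z : ℂ => if q.2.2.2 then z.im else z.re) ((fundamentalRep (Fin 2) (V q.1) : Matrix (Fin 2) (Fin 2) ℂ) q.2.1 q.2.2.1)) V (ee, i, j, false) : ℝ) : ℂ) + (((fun (V : GaugeConfig 3 L (Matrix.specialUnitaryGroup (Fin 2) ℂ)) (q : Edge 3 L × Fin (fundamentalLatticeRep 2).N × Fin (fundamentalLatticeRep 2).N × Bool) => (fun z : ℂ => if q.2.2.2 then z.im else z.re) ((fundamentalRep (Fin 2) (V q.1) : Matrix (Fin 2) (Fin 2) ℂ) q.2.1 q.2.2.1)) V (ee, i, j, true) : ℝ) : ℂ) * Complex.I) q.1)) q.2.1 q.2.2.1) else 0)| ≤ Real.sqrt 2 * ℓ := by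
  classical
  have hud : Differentiable ℝ u := hu.differentiable (by norm_num)
  have hLip' : ∀ y y' : (GaugeConfig 3 L (Matrix.specialUnitaryGroup (Fin 2) ℂ)), (∀ f, f ≠ n.1 → y f = y' f) →
      |u ((fun (V : GaugeConfig 3 L (Matrix.specialUnitaryGroup (Fin 2) ℂ)) (q : Edge 3 L × Fin (fundamentalLatticeRep 2).N × Fin (fundamentalLatticeRep 2).N × Bool) => (fun z : ℂ => if q.2.2.2 then z.im else z.re) ((fundamentalRep (Fin 2) (V q.1) : Matrix (Fin 2) (Fin 2) ℂ) q.2.1 q.2.2.1)) y) - u ((fun (V : GaugeConfig 3 L (Matrix.specialUnitaryGroup (Fin 2) ℂ)) (q : Edge 3 L × Fin (fundamentalLatticeRep 2).N × Fin (fundamentalLatticeRep 2).N × Bool) => (fun z : ℂ => if q.2.2.2 then z.im else z.re) ((fundamentalRep (Fin 2) (V q.1) : Matrix (Fin 2) (Fin 2) ℂ) q.2.1 q.2.2.1)) y')| ≤ ℓ * frobNorm ((fundamentalLatticeRep 2).ρ (y n.1) - (fundamentalLatticeRep 2).ρ (y' n.1)) :=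
    fun y y' h => hLip y y' h
  -- the generator `X₀ = √2·𝐩E_ν`, placed at the link `n.1`
  set P : Matrix (Fin (fundamentalLatticeRep 2).N) (Fin (fundamentalLatticeRep 2).N) ℂ := (fundamentalLatticeRep 2).lieProj (noiseDir n.2) with hP
  set X₀ : Matrix (Fin (fundamentalLatticeRep 2).N) (Fin (fundamentalLatticeRep 2).N) ℂ := (Real.sqrt 2 : ℂ) • P with hX₀
  have hPskew : Pᴴ = -P := by rw [← Matrix.star_eq_conjTranspose]; exact (fundamentalLatticeRep 2).star_lieProj _
  have hX₀skew : X₀ᴴ = -X₀ := by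
    rw [hX₀, Matrix.conjTranspose_smul, hPskew, smul_neg]
    have hs : star (Real.sqrt 2 : ℂ) = (Real.sqrt 2 : ℂ) := Complex.conj_ofReal _
    rw [hs]
  have hX₀mem : X₀ ∈ (fundamentalLatticeRep 2).lieAlg := by
    rw [hX₀, Complex.coe_smul]; exact Submodule.smul_mem _ _ ((fundamentalLatticeRep 2).lieProj_mem _)
  have hX₀tr : X₀.trace = 0 := trace_eq_zero_of_mem_lieAlg_two hX₀mem
  set X : Edge 3 L → Matrix (Fin (fundamentalLatticeRep 2).N) (Fin (fundamentalLatticeRep 2).N) ℂ := fun e => if e = n.1 then X₀ else 0 with hXdef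
  have hXskew : ∀ e, (X e)ᴴ = -(X e) := fun e => by
    by_cases he : e = n.1
    · simp only [hXdef, he, if_true]; exact hX₀skew
    · simp only [hXdef, he, if_false, Matrix.conjTranspose_zero, neg_zero]
  have hXtr : ∀ e, (X e).trace = 0 := fun e => by
    by_cases he : e = n.1
    · simp only [hXdef, he, if_true]; exact hX₀tr
    · simp only [hXdef, he, if_false, Matrix.trace_zero]
  set us : ℝ → (GaugeConfig 3 L (Matrix.specialUnitaryGroup (Fin 2) ℂ)) := fun s => (fun e => SUNBakryEmery.expSU (N := 2) (Y := Matrix.of fun i j : Fin 2 => X e i j) (hXskew e) (hXtr e) s) with hus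
  have hus0 : us 0 * V = V := by
    funext e
    have h1 : (SUNBakryEmery.expSU (N := 2) (Y := Matrix.of fun i j : Fin 2 => X e i j) (hXskew e) (hXtr e) (0 : ℝ)) = 1 :=
      Subtype.ext (by rw [SUNBakryEmery.coe_expSU, zero_smul, NormedSpace.exp_zero]; rfl)
    simp only [hus, Pi.mul_apply, h1, one_mul]
  -- the other links do not move
  have hfix : ∀ (s : ℝ) (f : Edge 3 L), f ≠ n.1 → (us s * V) f = V f := by
    intro s f hf
    have h1 : (SUNBakryEmery.expSU (N := 2) (Y := Matrix.of fun i j : Fin 2 => X f i j) (hXskew f) (hXtr f) s) = 1 := by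
      apply Subtype.ext
      rw [SUNBakryEmery.coe_expSU]
      have hz : (Matrix.of fun i j : Fin 2 => X f i j) = 0 := by
        ext i j; simp only [hXdef, hf, if_false, Matrix.of_apply]; rfl
      rw [hz, smul_zero, NormedSpace.exp_zero]; rfl
    simp only [hus, Pi.mul_apply, h1, one_mul]
  -- the moving link: `(us s * V) n.1 = e^(sX₀) V_(n.1)`
  have hmove : ∀ s : ℝ, (fundamentalLatticeRep 2).ρ ((us s * V) n.1) =
      NormedSpace.exp (s • X₀) * (fundamentalLatticeRep 2).ρ (V n.1) := by
    intro s
    have hof : (Matrix.of fun i j : Fin 2 => X n.1 i j) = X₀ := by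
      ext i j; simp only [hXdef, if_true, Matrix.of_apply]
    show (fundamentalLatticeRep 2).ρ ((us s) n.1 * V n.1) = _
    rw [map_mul]
    congr 1
    show ((SUNBakryEmery.expSU (N := 2) (Y := Matrix.of fun i j : Fin 2 => X n.1 i j) (hXskew n.1) (hXtr n.1) s :
      Matrix.specialUnitaryGroup (Fin 2) ℂ) : Matrix (Fin 2) (Fin 2) ℂ) = _
    rw [SUNBakryEmery.coe_expSU, hof]
    rfl
  -- the derivative of `φ(s) = u(coords(us s · V))` at `0` is the frame derivative `W_n u (coords V)`
  set φ : ℝ → ℝ := fun s => u ((fun (V : GaugeConfig 3 L (Matrix.specialUnitaryGroup (Fin 2) ℂ)) (q : Edge 3 L × Fin (fundamentalLatticeRep 2).N × Fin (fundamentalLatticeRep 2).N × Bool) => (fun z : ℂ => if q.2.2.2 then z.im else z.re) ((fundamentalRep (Fin 2) (V q.1) : Matrix (Fin 2) (Fin 2) ℂ) q.2.1 q.2.2.1)) (us s * V)) with hφ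
  have hder := hasDerivAt_comp_coords_multiFlow (L := L) X hXskew hXtr V hud 0
  have hdir : (fun q : Edge 3 L × Fin (fundamentalLatticeRep 2).N × Fin (fundamentalLatticeRep 2).N × Bool => (fun z : ℂ => if q.2.2.2 then z.im else z.re) ((X q.1 * (fun (ee : Edge 3 L) => Matrix.of fun (i j : Fin (fundamentalLatticeRep 2).N) => ((((fun (V : GaugeConfig 3 L (Matrix.specialUnitaryGroup (Fin 2) ℂ)) (q : Edge 3 L × Fin (fundamentalLatticeRep 2).N × Fin (fundamentalLatticeRep 2).N × Bool) => (fun z : ℂ => if q.2.2.2 then z.im else z.re) ((fundamentalRep (Fin 2) (V q.1) : Matrix (Fin 2) (Fin 2) ℂ) q.2.1 q.2.2.1)) (us 0 * V)) (ee, i, j, false) : ℝ) : ℂ) + ((((fun (V : GaugeConfig 3 L (Matrix.specialUnitaryGroup (Fin 2) ℂ)) (q : Edge 3 L × Fin (fundamentalLatticeRep 2).N × Fin (fundamentalLatticeRep 2).N × Bool) => (fun z : ℂ => if q.2.2.2 then z.im else z.re) ((fundamentalRep (Fin 2) (V q.1) : Matrix (Fin 2) (Fin 2) ℂ) q.2.1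 q.2.2.1)) (us 0 * V)) (ee, i, j, true) : ℝ) : ℂ) * Complex.I) q.1) q.2.1 q.2.2.1)) = (fun q : Edge 3 L × Fin (fundamentalLatticeRep 2).N × Fin (fundamentalLatticeRep 2).N × Bool => if n.1 = q.1 then (fun z : ℂ => if q.2.2.2 then z.im else z.re) (((Real.sqrt 2 : ℂ) • ((fundamentalLatticeRep 2).lieProj (noiseDir n.2) * (fun (ee : Edge 3 L) => Matrix.of fun (i j : Fin (fundamentalLatticeRep 2).N) => (((fun (V : GaugeConfig 3 L (Matrix.specialUnitaryGroup (Fin 2) ℂ)) (q : Edge 3 L × Fin (fundamentalLatticeRep 2).N × Fin (fundamentalLatticeRep 2).N × Bool) => (fun z : ℂ => if q.2.2.2 then z.im else z.re) ((fundamentalRep (Fin 2) (V q.1) : Matrix (Fin 2) (Fin 2) ℂ) q.2.1 q.2.2.1)) V (ee, i, j, false) : ℝ) : ℂ) + (((fun (V : GaugeConfig 3 L (Matrix.specialUnitaryGroup (Fin 2) ℂ)) (q : Edge 3 L × Fin (fundamentalLatticeRep 2).N × Fin (fundamentalLatticeRep 2).N × Bool) => (fun z : ℂ => if q.2.2.2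 then z.im else z.re) ((fundamentalRep (Fin 2) (V q.1) : Matrix (Fin 2) (Fin 2) ℂ) q.2.1 q.2.2.1)) V (ee, i, j, true) : ℝ) : ℂ) * Complex.I) q.1)) q.2.1 q.2.2.1) else 0) := by
    rw [hus0]
    funext q
    by_cases hq : n.1 = q.1
    · rw [if_pos hq]
      have hXq : X q.1 = X₀ := by rw [hXdef]; exact if_pos hq.symm
      rw [hXq, hX₀, Matrix.smul_mul]
    · rw [if_neg hq]
      have hXq : X q.1 = 0 := by rw [hXdef]; exact if_neg (fun h => hq h.symm)
      rw [hXq, Matrix.zero_mul]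
      simp
  have hφder : HasDerivAt φ (fderiv ℝ u ((fun (V : GaugeConfig 3 L (Matrix.specialUnitaryGroup (Fin 2) ℂ)) (q : Edge 3 L × Fin (fundamentalLatticeRep 2).N × Fin (fundamentalLatticeRep 2).N × Bool) => (fun z : ℂ => if q.2.2.2 then z.im else z.re) ((fundamentalRep (Fin 2) (V q.1) : Matrix (Fin 2) (Fin 2) ℂ) q.2.1 q.2.2.1)) V) (fun q : Edge 3 L × Fin (fundamentalLatticeRep 2).N × Fin (fundamentalLatticeRep 2).N × Bool => if n.1 = q.1 then (fun z : ℂ => if q.2.2.2 then z.im else z.re) (((Real.sqrt 2 : ℂ) • ((fundamentalLatticeRep 2).lieProj (noiseDir n.2) * (fun (ee : Edge 3 L) => Matrix.of fun (i j : Fin (fundamentalLatticeRep 2).N) => (((fun (V : GaugeConfig 3 L (Matrix.specialUnitaryGroup (Fin 2) ℂ)) (q : Edge 3 L × Fin (fundamentalLatticeRep 2).N × Fin (fundamentalLatticeRep 2).N × Bool) => (fun z : ℂ => if q.2.2.2 then z.im else z.re) ((fundamentalRep (Fin 2) (V q.1) : Matrix (Fin 2) (Fin 2) ℂ) q.2.1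 q.2.2.1)) V (ee, i, j, false) : ℝ) : ℂ) + (((fun (V : GaugeConfig 3 L (Matrix.specialUnitaryGroup (Fin 2) ℂ)) (q : Edge 3 L × Fin (fundamentalLatticeRep 2).N × Fin (fundamentalLatticeRep 2).N × Bool) => (fun z : ℂ => if q.2.2.2 then z.im else z.re) ((fundamentalRep (Fin 2) (V q.1) : Matrix (Fin 2) (Fin 2) ℂ) q.2.1 q.2.2.1)) V (ee, i, j, true) : ℝ) : ℂ) * Complex.I) q.1)) q.2.1 q.2.2.1) else 0)) 0 := by
    have h := hder
    rw [hdir, hus0] at h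
    exact h
  -- Lipschitz bound on the slopes: `|φ(s) − φ(0)| ≤ ℓ ‖e^(sX₀) − 1‖_F ≤ ℓ·s·‖X₀‖_F`
  obtain ⟨T, hT⟩ : ∃ T : Matrix (Fin (fundamentalLatticeRep 2).N) (Fin (fundamentalLatticeRep 2).N) ℂ →L[ℝ] EuclideanSpace ℂ (Fin (fundamentalLatticeRep 2).N × Fin (fundamentalLatticeRep 2).N), ∀ M, ‖T M‖ = frobNorm M := by
    let Tl : Matrix (Fin (fundamentalLatticeRep 2).N) (Fin (fundamentalLatticeRep 2).N) ℂ →ₗ[ℝ] EuclideanSpace ℂ (Fin (fundamentalLatticeRep 2).N × Fin (fundamentalLatticeRep 2).N) :=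
      { toFun := fun M => WithLp.toLp 2 (fun kl => M kl.1 kl.2)
        map_add' := fun v w => rfl
        map_smul' := fun c v => rfl }
    refine ⟨LinearMap.toContinuousLinearMap Tl, fun M => ?_⟩
    rw [LinearMap.coe_toContinuousLinearMap', EuclideanSpace.norm_eq, frobNorm]
    congr 1
    rw [Fintype.sum_prod_type]
    rfl
  have hXu : ∀ r : ℝ, NormedSpace.exp (r • X₀) ∈ Matrix.unitaryGroup (Fin (fundamentalLatticeRep 2).N) ℂ := fun r =>
    Matrix.specialUnitaryGroup_le_unitaryGroup (SUNBakryEmery.expSU (N := 2) hX₀skew hX₀tr r).2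
  have hEder : ∀ r : ℝ, HasDerivAt (fun r : ℝ => T (NormedSpace.exp (r • X₀))) (T (X₀ * NormedSpace.exp (r • X₀))) r := fun r =>
    T.hasFDerivAt.comp_hasDerivAt r (hasDerivAt_exp_smul_const' (𝕂 := ℝ) X₀ r)
  have hEbound : ∀ s : ℝ, 0 ≤ s → frobNorm (NormedSpace.exp (s • X₀) - 1) ≤ s * frobNorm X₀ := by
    intro s hs
    have hMV := norm_image_sub_le_of_norm_deriv_le_segment' (f := fun r : ℝ => T (NormedSpace.exp (r • X₀))) (a := (0 : ℝ)) (b := s)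
      (C := frobNorm X₀) (fun r _ => (hEder r).hasDerivWithinAt)
      (fun r _ => by rw [hT, frobNorm_mul_unitary _ (hXu r)]) s (Set.right_mem_Icc.2 hs)
    rw [← map_sub, hT, zero_smul, NormedSpace.exp_zero, sub_zero] at hMV
    rw [mul_comm]; exact hMV
  have hX₀norm : frobNorm X₀ ≤ Real.sqrt 2 := by
    rw [hX₀, frobNorm_smul, Complex.norm_real, Real.norm_eq_abs, abs_of_nonneg (Real.sqrt_nonneg 2)]
    have h : frobNorm P ≤ 1 := (frobNorm_lieProj_le (fundamentalLatticeRep 2) (noiseDir n.2)).trans (le_of_eq (frobNorm_noiseDir n.2))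
    have h2 : 0 ≤ Real.sqrt 2 := Real.sqrt_nonneg 2
    calc Real.sqrt 2 * frobNorm P ≤ Real.sqrt 2 * 1 := mul_le_mul_of_nonneg_left h h2
      _ = Real.sqrt 2 := mul_one _
  have hslope : ∀ s : ℝ, 0 < s → |slope φ 0 s| ≤ Real.sqrt 2 * ℓ := by
    intro s hs
    have hu0 : (fundamentalLatticeRep 2).ρ (V n.1) ∈ Matrix.unitaryGroup (Fin (fundamentalLatticeRep 2).N) ℂ :=
      Matrix.specialUnitaryGroup_le_unitaryGroup (V n.1).2
    have h1 : |φ s - φ 0| ≤ ℓ * frobNorm (NormedSpace.exp (s • X₀) - 1) := by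
      have h := hLip' (us s * V) V (fun f hf => hfix s f hf)
      rw [hmove s] at h
      have hfrob : frobNorm (NormedSpace.exp (s • X₀) * (fundamentalLatticeRep 2).ρ (V n.1) -
          (fundamentalLatticeRep 2).ρ (V n.1)) = frobNorm (NormedSpace.exp (s • X₀) - 1) := by
        rw [show NormedSpace.exp (s • X₀) * (fundamentalLatticeRep 2).ρ (V n.1) -
            (fundamentalLatticeRep 2).ρ (V n.1) =
          (NormedSpace.exp (s • X₀) - 1) * (fundamentalLatticeRep 2).ρ (V n.1) by rw [Matrix.sub_mul, Matrix.one_mul],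
          frobNorm_mul_unitary _ hu0]
      rw [hfrob] at h
      simpa only [hφ, hus0] using h
    rw [slope_def_field, sub_zero, abs_div, abs_of_pos hs, div_le_iff₀ hs]
    calc |φ s - φ 0| ≤ ℓ * frobNorm (NormedSpace.exp (s • X₀) - 1) := h1
      _ ≤ ℓ * (s * frobNorm X₀) := mul_le_mul_of_nonneg_left (hEbound s hs.le) hℓ
      _ ≤ ℓ * (s * Real.sqrt 2) := mul_le_mul_of_nonneg_left (mul_le_mul_of_nonneg_left hX₀norm hs.le) hℓ
      _ = Real.sqrt 2 * ℓ * s := by ring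
  -- pass to the limit `s → 0⁺`
  have htend : Tendsto (fun s => |slope φ 0 s|) (𝓝[>] (0 : ℝ)) (𝓝 |fderiv ℝ u ((fun (V : GaugeConfig 3 L (Matrix.specialUnitaryGroup (Fin 2) ℂ)) (q : Edge 3 L × Fin (fundamentalLatticeRep 2).N × Fin (fundamentalLatticeRep 2).N × Bool) => (fun z : ℂ => if q.2.2.2 then z.im else z.re) ((fundamentalRep (Fin 2) (V q.1) : Matrix (Fin 2) (Fin 2) ℂ) q.2.1 q.2.2.1)) V) (fun q : Edge 3 L × Fin (fundamentalLatticeRep 2).N × Fin (fundamentalLatticeRep 2).N × Bool => if n.1 = q.1 then (fun z : ℂ => if q.2.2.2 then z.im else z.re) (((Real.sqrt 2 : ℂ) • ((fundamentalLatticeRep 2).lieProj (noiseDir n.2) * (fun (ee : Edge 3 L) => Matrix.of fun (i j : Fin (fundamentalLatticeRep 2).N) => (((fun (V : GaugeConfig 3 L (Matrix.specialUnitaryGroup (Fin 2) ℂ)) (q : Edge 3 L × Fin (fundamentalLatticeRep 2).N × Fin (fundamentalLatticeRep 2).N × Bool) => (fun z : ℂ => if q.2.2.2 then z.im else z.re)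 ((fundamentalRep (Fin 2) (V q.1) : Matrix (Fin 2) (Fin 2) ℂ) q.2.1 q.2.2.1)) V (ee, i, j, false) : ℝ) : ℂ) + (((fun (V : GaugeConfig 3 L (Matrix.specialUnitaryGroup (Fin 2) ℂ)) (q : Edge 3 L × Fin (fundamentalLatticeRep 2).N × Fin (fundamentalLatticeRep 2).N × Bool) => (fun z : ℂ => if q.2.2.2 then z.im else z.re) ((fundamentalRep (Fin 2) (V q.1) : Matrix (Fin 2) (Fin 2) ℂ) q.2.1 q.2.2.1)) V (ee, i, j, true) : ℝ) : ℂ) * Complex.I) q.1)) q.2.1 q.2.2.1) else 0)|) :=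
    ((hφder.tendsto_slope.mono_left (nhdsWithin_mono _ fun s (hs : 0 < s) => ne_of_gt hs))).abs
  exact le_of_tendsto htend (eventually_nhdsWithin_of_forall fun s hs => hslope s hs)

end Frame

/-! ## §2. The carré du champ from a link-Lipschitz profile -/

/-- ★★ **Carré du champ from a link-Lipschitz profile.**  If `u` is `C¹` and, for every link `e`, `u∘coords` is `ℓ_e`-Lipschitz in the link
`e` (Frobenius distance of the link matrices, all other links frozen), then `Γ^A(u)(V) ≤ 16·Σ_e ℓ_e²` at EVERY configuration `V`: by the frame
dictionary `Γ^A(u) = Σ_(e,ν) (W_(e,ν)u)²` (`carre_eq_sum_frameDeriv_mul`), `8` noise directions per link and `|W_(e,ν)u| ≤ √2·ℓ_e`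
(`frameDeriv_abs_le_of_linkLipschitz`).  Converse companion of `oscillation_oneLink_le_of_carre_le`. [folklore] -/
theorem carre_le_of_linkLipschitz (L : ℕ) [NeZero L] (β' : ℝ) {u : (Edge 3 L × Fin 2 × Fin 2 × Bool → ℝ) → ℝ} (hu : ContDiff ℝ 1 u) {ℓ : Edge 3 L → ℝ} (hℓ : ∀ e, 0 ≤ ℓ e)
    (V : (GaugeConfig 3 L (Matrix.specialUnitaryGroup (Fin 2) ℂ))) :
    let coords : GaugeConfig 3 L (Matrix.specialUnitaryGroup (Fin 2) ℂ) → (Edge 3 L × Fin 2 × Fin 2 × Bool → ℝ) :=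
      fun V q => (fun z : ℂ => if q.2.2.2 then z.im else z.re)
        ((fundamentalRep (Fin 2) (V q.1) : Matrix (Fin 2) (Fin 2) ℂ) q.2.1 q.2.2.1)
    let A : GaugeConfig 3 L (Matrix.specialUnitaryGroup (Fin 2) ℂ) → (Edge 3 L × Fin 2 × Fin 2 × Bool) →
        (Edge 3 L × Fin 2 × Fin 2 × Bool) → ℝ := fun V i j =>
      ∑ n : Edge 3 L × NoiseIdx 2,
        (if n.1 = i.1 then (fun z : ℂ => if i.2.2.2 then z.im else z.re)
          ((latticeLangevinDynamics (fundamentalLatticeRep 2) β').noise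
            (matrixConfig (fundamentalRep (Fin 2)) V) i.1 n.2 i.2.1 i.2.2.1) else 0) *
        (if n.1 = j.1 then (fun z : ℂ => if j.2.2.2 then z.im else z.re)
          ((latticeLangevinDynamics (fundamentalLatticeRep 2) β').noise
            (matrixConfig (fundamentalRep (Fin 2)) V) j.1 n.2 j.2.1 j.2.2.1) else 0)
    (∀ (e : Edge 3 L) (y y' : (GaugeConfig 3 L (Matrix.specialUnitaryGroup (Fin 2) ℂ))), (∀ f, f ≠ e → y f = y' f) →
      |u (coords y) - u (coords y')| ≤ ℓ e * frobNorm ((y e : Matrix (Fin 2) (Fin 2) ℂ) - (y' e : Matrix (Fin 2) (Fin 2) ℂ))) →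
    (∑ i : Edge 3 L × Fin 2 × Fin 2 × Bool, ∑ j : Edge 3 L × Fin 2 × Fin 2 × Bool, fderiv ℝ u (coords V) (Pi.single i 1) * fderiv ℝ u (coords V) (Pi.single j 1) * A V i j) ≤
      16 * ∑ e : Edge 3 L, ℓ e ^ 2 := by
  intro coords A hLip
  classical
  have hframe : (∑ i : Edge 3 L × Fin 2 × Fin 2 × Bool, ∑ j : Edge 3 L × Fin 2 × Fin 2 × Bool, fderiv ℝ u (coords V) (Pi.single i 1) * fderiv ℝ u (coords V) (Pi.single j 1) * A V i j) =
      ∑ n : Edge 3 L × NoiseIdx (fundamentalLatticeRep 2).N, fderiv ℝ u (coords V) (fun q : Edge 3 L × Fin (fundamentalLatticeRep 2).N × Fin (fundamentalLatticeRep 2).N × Bool => if n.1 = q.1 then (fun z : ℂ => if q.2.2.2 then z.im else z.re) (((Real.sqrt 2 : ℂ) • ((fundamentalLatticeRep 2).lieProj (noiseDir n.2) * (fun (ee : Edge 3 L) => Matrix.of fun (i j : Fin (fundamentalLatticeRep 2).N) => ((coords V (ee, i, j, false) : ℝ) : ℂ) + ((coords V (ee, i, j, true) : ℝ) : ℂ)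 * Complex.I) q.1)) q.2.1 q.2.2.1) else 0) * fderiv ℝ u (coords V) (fun q : Edge 3 L × Fin (fundamentalLatticeRep 2).N × Fin (fundamentalLatticeRep 2).N × Bool => if n.1 = q.1 then (fun z : ℂ => if q.2.2.2 then z.im else z.re) (((Real.sqrt 2 : ℂ) • ((fundamentalLatticeRep 2).lieProj (noiseDir n.2) * (fun (ee : Edge 3 L) => Matrix.of fun (i j : Fin (fundamentalLatticeRep 2).N) => ((coords V (ee, i, j, false) : ℝ) : ℂ) + ((coords V (ee, i, j, true) : ℝ) : ℂ) * Complex.I) q.1)) q.2.1 q.2.2.1) else 0) :=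
    carre_eq_sum_frameDeriv_mul L β' u u V
  rw [hframe]
  have hb : ∀ n : Edge 3 L × NoiseIdx (fundamentalLatticeRep 2).N,
      fderiv ℝ u (coords V) (fun q : Edge 3 L × Fin (fundamentalLatticeRep 2).N × Fin (fundamentalLatticeRep 2).N × Bool => if n.1 = q.1 then (fun z : ℂ => if q.2.2.2 then z.im else z.re) (((Real.sqrt 2 : ℂ) • ((fundamentalLatticeRep 2).lieProj (noiseDir n.2) * (fun (ee : Edge 3 L) => Matrix.of fun (i j : Fin (fundamentalLatticeRep 2).N) => ((coords V (ee, i, j, false) : ℝ) : ℂ) + ((coords V (ee, i, j, true) : ℝ) : ℂ) * Complex.I) q.1)) q.2.1 q.2.2.1) else 0) * fderiv ℝ u (coords V) (fun q : Edge 3 L × Fin (fundamentalLatticeRep 2).N × Fin (fundamentalLatticeRep 2).N × Bool => if n.1 = q.1 then (fun z : ℂ => if q.2.2.2 then z.im else z.re) (((Real.sqrt 2 : ℂ) • ((fundamentalLatticeRep 2).lieProj (noiseDir n.2) * (fun (ee : Edge 3 L) => Matrix.of fun (i j : Fin (fundamentalLatticeRep 2).N) => ((coords V (ee, i, j, false)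 : ℝ) : ℂ) + ((coords V (ee, i, j, true) : ℝ) : ℂ) * Complex.I) q.1)) q.2.1 q.2.2.1) else 0) ≤ 2 * ℓ n.1 ^ 2 := by
    intro n
    have h' : |fderiv ℝ u (coords V) (fun q : Edge 3 L × Fin (fundamentalLatticeRep 2).N × Fin (fundamentalLatticeRep 2).N × Bool => if n.1 = q.1 then (fun z : ℂ => if q.2.2.2 then z.im else z.re) (((Real.sqrt 2 : ℂ) • ((fundamentalLatticeRep 2).lieProj (noiseDir n.2) * (fun (ee : Edge 3 L) => Matrix.of fun (i j : Fin (fundamentalLatticeRep 2).N) => ((coords V (ee, i, j, false) : ℝ) : ℂ) + ((coords V (ee, i, j, true) : ℝ) : ℂ) * Complex.I) q.1)) q.2.1 q.2.2.1) else 0)| ≤ Real.sqrt 2 * ℓ n.1 :=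
      frameDeriv_abs_le_of_linkLipschitz hu n (hℓ n.1) (fun y y' h => hLip n.1 y y' h) V
    have h0 : 0 ≤ Real.sqrt 2 * ℓ n.1 := mul_nonneg (Real.sqrt_nonneg 2) (hℓ n.1)
    have h2 := abs_le.1 h'
    have hs : Real.sqrt 2 * Real.sqrt 2 = 2 := Real.mul_self_sqrt (by norm_num)
    nlinarith [h2.1, h2.2, hs, h0]
  have hcard8 : Fintype.card (NoiseIdx (fundamentalLatticeRep 2).N) = 8 := by
    rw [Literature.MathematicalPhysics.QuantumLattice.fundamentalLatticeRep_N]; rfl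
  calc ∑ n : Edge 3 L × NoiseIdx (fundamentalLatticeRep 2).N, fderiv ℝ u (coords V) (fun q : Edge 3 L × Fin (fundamentalLatticeRep 2).N × Fin (fundamentalLatticeRep 2).N × Bool => if n.1 = q.1 then (fun z : ℂ => if q.2.2.2 then z.im else z.re) (((Real.sqrt 2 : ℂ) • ((fundamentalLatticeRep 2).lieProj (noiseDir n.2) * (fun (ee : Edge 3 L) => Matrix.of fun (i j : Fin (fundamentalLatticeRep 2).N) => ((coords V (ee, i, j, false) : ℝ) : ℂ) + ((coords V (ee, i, j, true) : ℝ) : ℂ) * Complex.I) q.1)) q.2.1 q.2.2.1) else 0) * fderiv ℝ u (coords V) (fun q : Edge 3 L × Fin (fundamentalLatticeRep 2).N × Fin (fundamentalLatticeRep 2).N × Bool => if n.1 = q.1 then (fun z : ℂ => if q.2.2.2 then z.im else z.re) (((Real.sqrt 2 : ℂ) • ((fundamentalLatticeRep 2).lieProj (noiseDir n.2) * (fun (ee : Edge 3 L) => Matrix.of fun (i j : Fin (fundamentalLatticeRep 2).N) => ((coords V (ee, i, j, false) : ℝ) : ℂ) + ((coords V (ee, i, j, true) : ℝ) : ℂ)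 * Complex.I) q.1)) q.2.1 q.2.2.1) else 0)
      ≤ ∑ n : Edge 3 L × NoiseIdx (fundamentalLatticeRep 2).N, 2 * ℓ n.1 ^ 2 := Finset.sum_le_sum fun n _ => hb n
    _ = ∑ e : Edge 3 L, ∑ _ν : NoiseIdx (fundamentalLatticeRep 2).N, 2 * ℓ e ^ 2 := by rw [Fintype.sum_prod_type]
    _ = ∑ e : Edge 3 L, 8 * (2 * ℓ e ^ 2) := by
        refine Finset.sum_congr rfl fun e _ => ?_
        rw [Finset.sum_const, Finset.card_univ, hcard8, nsmul_eq_mul]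
        push_cast; ring
    _ = 16 * ∑ e : Edge 3 L, ℓ e ^ 2 := by rw [Finset.mul_sum]; exact Finset.sum_congr rfl fun e _ => by ring

/-! ## §3. Every-start, volume-free mixing of local observables — Lipschitz-only hypotheses -/

/-- ★★★ **Every-start mixing of local observables with volume-free constants, LIPSCHITZ-ONLY form.**  At `|β'| < 1/12`, for every torus
size `L`, every Markov kernel family `κ` realising the `SU(2)` SZZ transition laws, every finite set of links `Λ`, every `C⁵` observable `f`
whose pull-back `f∘coords` has a link-Lipschitz profile `ℓ ≥ 0` SUPPORTED IN `Λ` (`ℓ_e = 0` off `Λ`; Frobenius distance of the link matrices,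
other links frozen), every time `t` and EVERY start `x`:
`|κ_t(f∘coords)(x) − ∫ f∘coords dμ_(β')| ≤ 12π·#Λ·√(Σ_e ℓ_e²)·((3(λ+ρ)t + 1)³ + 2)·e^(−ρt)`, `ρ = 1 − 12|β'|`, `λ = (1300+4√2)|β'|` — no
carré du champ and no locality hypothesis in the statement: `Γ^A(f) ≤ 16Σℓ²` is `carre_le_of_linkLipschitz` and locality off `Λ` follows from
`ℓ = 0` there by telescoping (`abs_sub_le_sum_linkLipschitz`); then `wilson_local_pointwise_mixing_uniform` with `σ = 4√(Σℓ²)`.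
HONEST FRAMING: fixed cut-off, fixed `|β'| < 1/12`, nothing `K`-uniform, 24809 not restated, YM mass gap NOT proved. [folklore] -/
theorem wilson_local_pointwise_mixing_of_linkLipschitz (L : ℕ) [NeZero L] (β' : ℝ) (hβ : |β'| < 1 / 12)
    (κ : ℝ≥0 → Kernel (GaugeConfig 3 L (Matrix.specialUnitaryGroup (Fin 2) ℂ))
      (GaugeConfig 3 L (Matrix.specialUnitaryGroup (Fin 2) ℂ))) [∀ t, IsMarkovKernel (κ t)]
    (hreal : ∀ (t : ℝ≥0) (x : GaugeConfig 3 L (Matrix.specialUnitaryGroup (Fin 2) ℂ))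
        (Ω : Type) [MeasurableSpace Ω] (P : Measure Ω) [IsProbabilityMeasure P]
        (W : ℝ≥0 → Ω → (Edge 3 L × NoiseIdx 2 → ℝ)) (hW : IsFlatBrownian W P)
        (U : ℝ≥0 → Ω → GaugeConfig 3 L (Matrix.specialUnitaryGroup (Fin 2) ℂ)),
        (∀ ω, U 0 ω = x) →
        (latticeLangevinDynamics (fundamentalLatticeRep 2) β').IsSolution (fundamentalRep (Fin 2))
          hW.natFiltration P W U →
        κ t x = P.map (U t))
    {f : (Edge 3 L × Fin 2 × Fin 2 × Bool → ℝ) → ℝ} (hf : ContDiff ℝ 5 f) (Λ : Finset (Edge 3 L)) {ℓ : Edge 3 L → ℝ} (hℓ : ∀ e, 0 ≤ ℓ e)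
    (hℓΛ : ∀ e, e ∉ Λ → ℓ e = 0) (t : ℝ≥0) :
    let coords : GaugeConfig 3 L (Matrix.specialUnitaryGroup (Fin 2) ℂ) → (Edge 3 L × Fin 2 × Fin 2 × Bool → ℝ) :=
      fun V q => (fun z : ℂ => if q.2.2.2 then z.im else z.re)
        ((fundamentalRep (Fin 2) (V q.1) : Matrix (Fin 2) (Fin 2) ℂ) q.2.1 q.2.2.1)
    (∀ (e : Edge 3 L) (y y' : (GaugeConfig 3 L (Matrix.specialUnitaryGroup (Fin 2) ℂ))), (∀ g, g ≠ e → y g = y' g) →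
      |f (coords y) - f (coords y')| ≤ ℓ e * frobNorm ((y e : Matrix (Fin 2) (Fin 2) ℂ) - (y' e : Matrix (Fin 2) (Fin 2) ℂ))) →
    ∀ x, |∫ y, f (coords y) ∂(κ t x) - ∫ y, f (coords y) ∂(wilsonMeasure (d := 3) (L := L) (fundamentalRep (Fin 2)) β')| ≤
      12 * Real.pi * Λ.card * Real.sqrt (∑ e : Edge 3 L, ℓ e ^ 2) * ((3 * (((1300 + 4 * Real.sqrt 2) * |β'| + (1 - 12 * |β'|)) * (t : ℝ)) + 1) ^ 3 + 2) * Real.exp (-((1 - 12 * |β'|) * (t : ℝ))) := by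
  intro coords hLip x
  classical
  have hf1 : ContDiff ℝ 1 f := hf.of_le (by norm_num)
  set S : ℝ := Real.sqrt (∑ e : Edge 3 L, ℓ e ^ 2) with hS
  have hS0 : 0 ≤ S := Real.sqrt_nonneg _
  have hσ : (0 : ℝ) ≤ 4 * S := by positivity
  have h16 : (4 * S) ^ 2 = 16 * ∑ e : Edge 3 L, ℓ e ^ 2 := by
    rw [mul_pow, hS, Real.sq_sqrt (Finset.sum_nonneg fun e _ => sq_nonneg (ℓ e))]; norm_num
  have hΓ := fun y : (GaugeConfig 3 L (Matrix.specialUnitaryGroup (Fin 2) ℂ)) => carre_le_of_linkLipschitz L β' hf1 hℓ y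
  -- locality off `Λ` from `ℓ = 0` there
  have hloc : ∀ y y' : (GaugeConfig 3 L (Matrix.specialUnitaryGroup (Fin 2) ℂ)), (∀ e ∈ Λ, y e = y' e) → f (coords y) = f (coords y') := by
    intro y y' hyy'
    have h := abs_sub_le_sum_linkLipschitz (F := fun y : (GaugeConfig 3 L (Matrix.specialUnitaryGroup (Fin 2) ℂ)) => f (coords y)) ℓ hLip y y'
    have h0 : ∑ e : Edge 3 L, ℓ e * frobNorm ((y e : Matrix (Fin 2) (Fin 2) ℂ) - (y' e : Matrix (Fin 2) (Fin 2) ℂ)) = 0 := by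
      refine Finset.sum_eq_zero fun e _ => ?_
      by_cases he : e ∈ Λ
      · rw [hyy' e he, sub_self, frobNorm_zero, mul_zero]
      · rw [hℓΛ e he, zero_mul]
    rw [h0] at h
    have h1 : |f (coords y) - f (coords y')| = 0 := le_antisymm h (abs_nonneg _)
    rw [abs_eq_zero, sub_eq_zero] at h1
    exact h1
  have key := wilson_local_pointwise_mixing_uniform L β' hβ κ hreal hf hσ Λ t
    (fun y => by rw [h16]; exact hΓ y hLip) hloc x
  calc |∫ y, f (coords y) ∂(κ t x) - ∫ y, f (coords y) ∂(wilsonMeasure (d := 3) (L := L) (fundamentalRep (Fin 2)) β')|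
      ≤ 3 * Real.pi * Λ.card * (4 * S) * ((3 * (((1300 + 4 * Real.sqrt 2) * |β'| + (1 - 12 * |β'|)) * (t : ℝ)) + 1) ^ 3 + 2) * Real.exp (-((1 - 12 * |β'|) * (t : ℝ))) := key
    _ = 12 * Real.pi * Λ.card * S * ((3 * (((1300 + 4 * Real.sqrt 2) * |β'| + (1 - 12 * |β'|)) * (t : ℝ)) + 1) ^ 3 + 2) * Real.exp (-((1 - 12 * |β'|) * (t : ℝ))) := by ring

/-- ★★★ **The same ALONG EVERY SZZ SOLUTION** (any filtered probability space with a flat Brownian driver, any strong solution `U` from a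
deterministic start `x₀`, e.g. the COLD start): `|E[f(coords U_t)] − ∫ f∘coords dμ_(β')| ≤ 12π·#Λ·√(Σ_e ℓ_e²)·((3(λ+ρ)t+1)³+2)·e^(−ρt)`
for every `C⁵` `f` with a link-Lipschitz profile `ℓ` supported in `Λ`; volume-free.  Fixed cut-off, fixed `|β'| < 1/12`; 24809 is NOT
restated. [folklore] -/
theorem wilson_solution_local_pointwise_mixing_of_linkLipschitz (L : ℕ) [NeZero L] (β' : ℝ) (hβ : |β'| < 1 / 12) (t : ℝ≥0)
    (x₀ : (GaugeConfig 3 L (Matrix.specialUnitaryGroup (Fin 2) ℂ)))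
    (Ω : Type) [MeasurableSpace Ω] (P : Measure Ω) [IsProbabilityMeasure P]
    (W : ℝ≥0 → Ω → (Edge 3 L × NoiseIdx 2 → ℝ)) (hW : IsFlatBrownian W P)
    (U : ℝ≥0 → Ω → (GaugeConfig 3 L (Matrix.specialUnitaryGroup (Fin 2) ℂ))) (hU0 : ∀ ω, U 0 ω = x₀)
    (hU : (latticeLangevinDynamics (fundamentalLatticeRep 2) β').IsSolution (fundamentalRep (Fin 2)) hW.natFiltration P W U)
    {f : (Edge 3 L × Fin 2 × Fin 2 × Bool → ℝ) → ℝ} (hf : ContDiff ℝ 5 f) (Λ : Finset (Edge 3 L)) {ℓ : Edge 3 L → ℝ} (hℓ : ∀ e, 0 ≤ ℓ e)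
    (hℓΛ : ∀ e, e ∉ Λ → ℓ e = 0) :
    let coords : GaugeConfig 3 L (Matrix.specialUnitaryGroup (Fin 2) ℂ) → (Edge 3 L × Fin 2 × Fin 2 × Bool → ℝ) :=
      fun V q => (fun z : ℂ => if q.2.2.2 then z.im else z.re)
        ((fundamentalRep (Fin 2) (V q.1) : Matrix (Fin 2) (Fin 2) ℂ) q.2.1 q.2.2.1)
    (∀ (e : Edge 3 L) (y y' : (GaugeConfig 3 L (Matrix.specialUnitaryGroup (Fin 2) ℂ))), (∀ g, g ≠ e → y g = y' g) →
      |f (coords y) - f (coords y')| ≤ ℓ e * frobNorm ((y e : Matrix (Fin 2) (Fin 2) ℂ) - (y' e : Matrix (Fin 2) (Fin 2) ℂ))) →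
    |∫ ω, f (coords (U t ω)) ∂P - ∫ y, f (coords y) ∂(wilsonMeasure (d := 3) (L := L) (fundamentalRep (Fin 2)) β')| ≤
      12 * Real.pi * Λ.card * Real.sqrt (∑ e : Edge 3 L, ℓ e ^ 2) * ((3 * (((1300 + 4 * Real.sqrt 2) * |β'| + (1 - 12 * |β'|)) * (t : ℝ)) + 1) ^ 3 + 2) * Real.exp (-((1 - 12 * |β'|) * (t : ℝ))) := by
  intro coords hLip
  classical
  haveI := secondCountableTopology_su2
  haveI := borelSpace_config L
  obtain ⟨κ, hκ, -, hreal⟩ := exists_transitionKernel L β'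
  haveI := hκ
  have h := wilson_local_pointwise_mixing_of_linkLipschitz L β' hβ κ hreal hf Λ hℓ hℓΛ t hLip x₀
  have hlaw : κ t x₀ = P.map (U t) := hreal t x₀ Ω P W hW U hU0 hU
  have hmU : Measurable (U t) := (hU.adapted t).mono (hW.natFiltration.le t) le_rfl
  have hFm : Measurable fun y : (GaugeConfig 3 L (Matrix.specialUnitaryGroup (Fin 2) ℂ)) => f (coords y) :=
    (hf.continuous.comp (continuous_coords (L := L))).measurable
  have e1 : ∫ y, f (coords y) ∂(κ t x₀) = ∫ ω, f (coords (U t ω)) ∂P := by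
    rw [hlaw, integral_map hmU.aemeasurable hFm.aestronglyMeasurable]
  rw [← e1]
  exact h

end Summit.QuantumFields.YangMills.Theorems.ColdStartUniversality.LiebRobinson
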